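import Literature.MathematicalPhysics.QuantumFieldTheory.Balaban1983to89.B3Op116CollarBinders
import Literature.MathematicalPhysics.QuantumFieldTheory.Balaban1983to89.B3Ineq25Op116SmoothInner

/-!
# Bałaban, *(Higgs)₂,₃ quantum fields in a finite volume III. Renormalization* [B3] — inequality (2.5) p. 424 for the ONE-`V_k`
COLLAR OPERATOR `(1.16)_{1,0}` / `(1.16)_{0,1}` of a far-supported perturbation `P` ON A `k`-BLOCK UNION `Ω`, AT HÖLDER EXPONENT
`α = 0`, FROM THE (2.10) DICTIONARY OF `G_k(Ω,Y)` AND `G_k(Ω,P+Y)` — file «CollarRegion» of the cell's Route δ (class (c) of p. 433),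
the (B)-level member: dictionary entries and far geometry in, `Ineq25At 1 0 0` out

statement-level skeleton of published theorems with citation tags; proofs where landed; nothing here is a claim about the Yang–Mills mass gap

T. Bałaban, Commun. Math. Phys. **88** (1983) 411–445 [cite: Balaban1983Higgs3]; part I, Commun. Math. Phys. **85** (1982) 603–636
[cite: Balaban1982Higgs1].  PDFs held: `paper:balaban1983-higgs-2-3-quantum-fields-finite-volume` (journal page = PDF page + 410;
p. 414 = `p0004.txt`, p. 424 = `p0014.txt`, p. 433 = `p0023.txt`).

CITATION HEADER (lean-in-tree rule).  Cell `lit-balaban` (HOME `run/shared/lean/pub/lit-balaban/`), Phase-2 proof seat **p40** gen 77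
(unit `lit-balaban-p40`, literature-prover-lit-balaban-p40-g77-0); free-target protocol G.5-34(d), TAKING line HOME/STATUS.md
2026-08-23T12:41:06Z (cc r15 = fold owner of rows B3.Txt@433 / B3.Prop1 / B3.Eq1.16 / B3.Eq2.5 / B3.Eq2.10, p35, r14, p33); design note
`lit-balaban-p40/DESIGN-B3-116-box.md` v3 §5/§5.1 (Route δ; HOME/GAPS.md «G-B3-16 ADDENDUM 1», owner note l.2887: the cell's recorded
proof-route deviation for class (c); print's one-piece expansion on `□` is the located open gap G-B3-16.A1).  LOCATED MEMBER of the
route — no head claim (decl of record `B3Sect2StatementsPart2.ScaledKernels.Ineq25At`, r15).  USED BY NAME, never restated: p40 g77's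
`B3Op116CollarBinders.{value_binder_one_zero, value_binder_zero_one, deriv_binder_one_zero, deriv_binder_zero_one, mixed_binder_one_zero,
mixed_binder_zero_one}`, `B3Op116CollarKernel.holder_row_zero_of_deriv_row`, `B3Op116CollarRows.{top, farF, collarC, farF_pos, collarC_nonneg,
mesh_eq_pow_mul_mesh}`, `B3Ineq25Op116SmoothInner.ineq25At_op116_smooth_of_bounds_inner`, p40 g72's carrier `B3Ineq25Op116Smooth.sect2Smooth116`,
p33's `B3Ineq25SmoothLocalization.{sect2DeltaSmooth, ineq25_smooth_regularNested}`, `B3Ineq31SmoothLocalization.smoothConst`, r14's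
`B3Ineq210RegularRegion.{Interior, blockUnion_of_isBigBlockUnion}`, p35's `B3Op116BoxRows.colB_dcolB_le`, p40's `B3Op116CollarDict.mixedB_le`,
r14's `B1Ineq225RegularBox.{cellBox, isBigBlockUnion_cellBox}`.

## What is printed

[B3] p. 424 (2.5) [PDF 14]: the exponential `(1,α)`-norm bound for the kernels localized by two functions of the class (2.3);
p. 414 [PDF 4]: *"the Hölder norms of the covariant derivatives of this kernel … are exponentially decaying with the distance of the
arguments and are uniformly bounded by O(1)(e(L^kε)^{1−α})^{n+n′}"*; p. 433 [PDF 23] (class (c)): *"We have B̃ = B̃₀ + B̃′, and we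
expand in B̃′ … we include the operators (1.16) … into the external fields"*.

## What this file proves, and how

§1 currency: `(ε^d)^{−1}·top_k(c, n+1; δ′)(x,x′) ≤ C·L^kε·((L^kε)^n((L^kε)^d)^{−1})·e^{−δ′|x−x′|/L^k}` for `(ε^d)^{−1}c ≤ C` (`top_le_binder`).
§3 **`ineq25At_one_zero_collarBox`** — THE (C)-LEVEL MEMBER on `Ω = cellBox k K₀ S`: the six dictionary families DISCHARGED by p35 g21's
`B3Op116BoxRows.colB_dcolB_le` (for `Y` and `P+Y`, both (I.2.23)-regular on `Ω`, `L^kδ|e| ≤ t`) and p40's `B3Op116CollarDict.mixedB_le`, the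
`δG_k` clause by p33 g61's `ineq25_smooth_regularNested` (`e² ≤ E₀`, `L^kδ_Y ≤ c|e|`), at a common cube size and rate; what remains as
hypotheses is configuration data only: `Ω₂` a big-block union `⊆ Ω`, `sup|P| ≤ s`, `ρ ≥ 1`, and the far geometry of `supp P` from the
interior points of `Ω₂`.  Conclusion `∃ K ≥ 0, (sect2Smooth116 …).Ineq25At 1 0 0 (min δ₀ (δ/4)) (C_G + (ε^d)^{−1}·farF(δ,ρ)·K)` with the
witness `K` the explicit §2 combination (visible in the proof term).
§2 **`ineq25At_one_zero_collar_of_dict`**: `Ω` a `k`-block union (`m² > 0`, `a_k ≥ 0`), `1 ≤ k ≤ K`, `L ≥ 2`, `0 < δ ≤ 1`, `ρ ≥ 1`;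
perturbation `P` with `sup|P| ≤ s`; GIVEN the six dictionary families in `maj` currency — value columns (exponent `2`), differentiated
columns at bonds `⊂ Ω` (exponent `1`) and mixed entries between bonds `⊂ Ω` (exponent `0`) of `G_k(Ω,Y)` (with `D^ε_Y`, `dip^Y`) and of
`G_k(Ω,P+Y)` (with `D^ε_{P+Y}`, `dip^{P+Y}`) —, the localization region `Ω₂` whose `Interior` points lie in `Ω` together with their forward
neighbours and are `ρL^k`-FAR (with the sites of every `k`-block met by `supp P`) from `supp P`, and the `δG_k(Ω,Ω₂,Y)` clause at `(0, δ_G, C_G)`: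
`(sect2Smooth116 … P Y … (L^kε) 1).Ineq25At 1 0 0 (min δ_G (δ/4)) (C_G + (ε^d)^{−1}·farF(δ,ρ)·K)` with `K` explicit in the dictionary constants
(`collarC` of the six rows, p33's `smoothConst`), `farF = farC·e^{−δρ/4}` — the eight binders of the inner-`Good` assembly from §2–§4 of
`B3Op116CollarBinders` (value, derivative, mixed) and F3's `holder_row_zero_of_deriv_row` (`α = 0`).

## Honest scope

§2 is (B)-level (dictionary entries, the `δG_k` clause and the geometry are hypotheses); §3 discharges the dictionary and the `δG_k`
clause on a cell-product box, keeping the configuration data (regularity/smallness of `Y`, `P+Y`, the far geometry, `Ω₂`) as hypotheses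
— whether print's class-(c) configuration on `□` (p. 433: `B̃ = B̃₀ + B̃′`, `R = ρL^k`) satisfies them is the plug of a later file;
Hölder exponent `α = 0` ONLY (print's `α > 0` needs F4 `B3Op116CollarHolder` + the near/far split); the constant is explicit but NOT in
print's running currency `O(1)(e(L^kε)^{1−α})^{n+n′}` (declared divergence: `K` depends on `k` through `collarC`, and `e_R := L^kε`,
`p_R := 1` are bookkeeping choices); orders `(n,n′) ∈ {(1,0),(0,1)}` (both conclusions; the `(0,1)` call feeds the same eight binders
with the roles of the two alternatives exchanged).  HYPOTHESIS STRENGTH: `sup|P| ≤ s` is taken TORUS-WIDE although the rows only read `P` on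
the bonds with an endpoint in `Ω` and their predecessors; print controls `B̃′` on `□` only, so a caller localizes this hypothesis or modifies
`P` away from `Ω` (successor bookkeeping; the operator is unchanged).  The class-(c) use on `□` is a RECORDED ROUTE DEVIATION from p. 433
l.12–15 (G-B3-16.A1).  Theorems only: no `def`, no
`def … : Prop`, no new named fact, no `sorry`; axioms standard.  Value = located member of a by-reference step of B3 — NOT summit progress
and nothing about the Yang–Mills mass gap.
-/

noncomputable section

open scoped BigOperators

namespace Literature.MathematicalPhysics.QuantumFieldTheory.Balaban1983to89.B3Ineq25Op116CollarRegion

open HiggsLattice (ChargeData ScalarField covDeriv)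
open HiggsCovariance (propagatorK E)
open HiggsCovariancePos (Inside)
open HiggsAveraging (blockK blockIter)
open B1Eq230FluctCov (Ix cb)
open B1TorusChainTransport (hol)
open B3Ineq211RegularTorus (IsAdm)
open B3Ineq210RegularRegion (Interior)
open B3Ineq210MixedRegularTorus (onb dip)
open B3Eq116TwoSidedExpansion (op116)
open B3Op116MajorantStep (maj)
open B3Op116CollarRows (Far top farF collarC farF_pos collarC_nonneg mesh_eq_pow_mul_mesh top_const_mono top_nonneg)
open B3Op116CollarBinders (value_binder_one_zero value_binder_zero_one deriv_binder_one_zero deriv_binder_zero_one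
  mixed_binder_one_zero mixed_binder_zero_one)
open B3Op116CollarKernel (holder_row_zero_of_deriv_row)
open B3Ineq31SmoothLocalization (smoothConst)
open B3Ineq25SmoothLocalization (sect2DeltaSmooth)
open B3Ineq25Op116Smooth (sect2Smooth116)
open B3Ineq25Op116SmoothInner (ineq25At_op116_smooth_of_bounds_inner)
open B1TorusCubeCover (half)
open B1TorusRegionHSizes (IsBigBlockUnion)
open B1Ineq225RegularBox (cellBox isBigBlockUnion_cellBox)
open B3Ineq210RegularRegion (blockUnion_of_isBigBlockUnion)
open B3Ineq25SmoothLocalization (ineq25_smooth_regularNested)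
open B3Op116BoxRows (colB_dcolB_le)
open B3Op116CollarDict (mixedB_le)
open B3Op116MajorantStep (maj_rate_mono)

variable {P : HiggsLattice.Params} {N : ℕ}

/-! ## §1 Currency: a top bump in the binder shape of the (1.32)-norm assembly -/

section Currency

/-- `(ε^d)^{−1}·top_k(c, n+1; δ′)(x,x′) ≤ C·L^kε·((L^kε)^n((L^kε)^d)^{−1})·e^{−δ′|x−x′|/L^k}` when `(ε^d)^{−1}c ≤ C`
(`(L^kε)^{n+1−d} = L^kε·(L^kε)^n·((L^kε)^d)^{−1}`, `(L^kε)^{−1}·ε|x−x′| = |x−x′|/L^k`). [cite: Balaban1983Higgs3, (2.5) p.424, (2.10) p.426] -/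
theorem top_le_binder {k : ℕ} {c C : ℝ} (hcC : (P.mesh 0 ^ P.d)⁻¹ * c ≤ C) (n : ℕ) (δ' : ℝ) (x x' : HiggsLattice.Site P 0) :
    (P.mesh 0 ^ P.d)⁻¹ * top P k c ((n : ℝ) + 1) δ' x x'
      ≤ C * P.mesh k * (P.mesh k ^ n * (P.mesh k ^ P.d)⁻¹) *
          Real.exp (-(δ' * ((HiggsLattice.Site.tdist x x' : ℝ) / (P.L : ℝ) ^ k))) := by
  have hm : 0 < P.mesh k := P.mesh_pos k
  have hm0 : 0 < P.mesh 0 := P.mesh_pos 0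
  have hpow : P.mesh k ^ ((n : ℝ) + 1 - (P.d : ℝ)) = P.mesh k * (P.mesh k ^ n * (P.mesh k ^ P.d)⁻¹) := by
    rw [show (n : ℝ) + 1 - (P.d : ℝ) = ((n + 1 : ℕ) : ℝ) - ((P.d : ℕ) : ℝ) by push_cast; ring, Real.rpow_sub hm,
      Real.rpow_natCast, Real.rpow_natCast, pow_succ, div_eq_mul_inv]
    ring
  have hrate : δ' * (P.mesh k)⁻¹ * (P.mesh 0 * (HiggsLattice.Site.tdist x x' : ℝ))
      = δ' * ((HiggsLattice.Site.tdist x x' : ℝ) / (P.L : ℝ) ^ k) := by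
    have hmk : P.mesh k = (P.L : ℝ) ^ k * P.mesh 0 := by
      have h := mesh_eq_pow_mul_mesh (P := P) (Nat.zero_le k); rwa [Nat.sub_zero] at h
    rw [hmk, mul_inv, div_eq_mul_inv]
    field_simp
  have hE : 0 ≤ P.mesh k * (P.mesh k ^ n * (P.mesh k ^ P.d)⁻¹) *
      Real.exp (-(δ' * ((HiggsLattice.Site.tdist x x' : ℝ) / (P.L : ℝ) ^ k))) := by positivity
  calc (P.mesh 0 ^ P.d)⁻¹ * top P k c ((n : ℝ) + 1) δ' x x'
      = ((P.mesh 0 ^ P.d)⁻¹ * c) * (P.mesh k * (P.mesh k ^ n * (P.mesh k ^ P.d)⁻¹) *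
          Real.exp (-(δ' * ((HiggsLattice.Site.tdist x x' : ℝ) / (P.L : ℝ) ^ k)))) := by
        rw [top, hpow, hrate]; ring
    _ ≤ C * (P.mesh k * (P.mesh k ^ n * (P.mesh k ^ P.d)⁻¹) *
          Real.exp (-(δ' * ((HiggsLattice.Site.tdist x x' : ℝ) / (P.L : ℝ) ^ k)))) := mul_le_mul_of_nonneg_right hcC hE
    _ = _ := by ring

end Currency

/-! ## §2 The member: `Ineq25At 1 0 0` for the collar operator from the dictionary -/

section Member

open scoped Classical

variable {K₀ r₀ m : ℕ} {hL1 : 1 < P.L} (C : ChargeData N) (Ω Ω₂ : Finset (HiggsLattice.Site P 0)) (Pf Y : HiggsLattice.VecField P 0)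
  {msq : ℝ} (a : ℝ) {k : ℕ} {c₁ c₂ : ℝ}
  (hmsq : 0 < msq) (hak : 0 ≤ B1.aSeq a P.L k)
  (hΩ : ∀ x x' : HiggsLattice.Site P 0, blockIter k x = blockIter k x' → (x ∈ Ω ↔ x' ∈ Ω))
include hmsq hak hΩ

/-- **INEQUALITY (2.5) AT `(n,n′) = (1,0)`, HÖLDER EXPONENT `α = 0`, FOR THE ONE-`V_k` COLLAR OPERATOR ON A `k`-BLOCK UNION, FROM THE
(2.10) DICTIONARY** (see the module docstring, §2).
[cite: Balaban1983Higgs3, (2.5) p.424, (1.16) p.414, (2.10) p.426, (1.32) p.420, p.433] [cite: Balaban1982Higgs1, Prop. 2.1 p.610, (3.16) p.615] -/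
theorem ineq25At_one_zero_collar_of_dict (hL2 : 2 ≤ P.L) (hk1 : 1 ≤ k) (hkK : k ≤ P.K) {δ ρ : ℝ} (hδ : 0 < δ) (hδ1 : δ ≤ 1)
    (hρ : 1 ≤ ρ) {s cY cYd cYm cPY cPYd cPYm : ℝ} (hs : 0 ≤ s) (hcY : 0 ≤ cY) (hcYd : 0 ≤ cYd) (hcYm : 0 ≤ cYm) (hcPY : 0 ≤ cPY)
    (hcPYd : 0 ≤ cPYd) (hcPYm : 0 ≤ cPYm) (hP : ∀ b : HiggsLattice.PBond P 0, |Pf b| ≤ s) (i₀ : Ix N)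
    (hc₁ : 0 ≤ c₁) (hc₂ : 0 ≤ c₂) {δG CG : ℝ} (hCG : 0 ≤ CG)
    (hδG : (sect2DeltaSmooth hL1 C Ω Ω₂ Y msq a k K₀ r₀ m c₁ c₂).Ineq25 0 δG CG)
    (hcolY : ∀ u y : HiggsLattice.Site P 0, u ∈ Ω → y ∈ Ω →
      ∑ i : Ix N, ‖propagatorK C Ω Y msq a k (cb P N 0 (y, i)) u‖ ≤ maj P k cY 2 δ u y)
    (hdcolY : ∀ y ∈ Ω, ∀ b : HiggsLattice.PBond P 0, Inside Ω b →
      ∑ i : Ix N, ‖covDeriv C Y (propagatorK C Ω Y msq a k (cb P N 0 (y, i))) b‖ ≤ maj P k cYd 1 δ b.src y)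
    (hmixY : ∀ b b' : HiggsLattice.PBond P 0, Inside Ω b → Inside Ω b' →
      (P.mesh 0)⁻¹ * ∑ i : Ix N, ‖covDeriv C Y (propagatorK C Ω Y msq a k (dip C Y b' (onb N i))) b‖ ≤ maj P k cYm 0 δ b.src b'.src)
    (hcolPY : ∀ u y : HiggsLattice.Site P 0, u ∈ Ω → y ∈ Ω →
      ∑ i : Ix N, ‖propagatorK C Ω (Pf + Y) msq a k (cb P N 0 (y, i)) u‖ ≤ maj P k cPY 2 δ u y)
    (hdcolPY : ∀ y ∈ Ω, ∀ b : HiggsLattice.PBond P 0, Inside Ω b →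
      ∑ i : Ix N, ‖covDeriv C (Pf + Y) (propagatorK C Ω (Pf + Y) msq a k (cb P N 0 (y, i))) b‖ ≤ maj P k cPYd 1 δ b.src y)
    (hmixPY : ∀ b b' : HiggsLattice.PBond P 0, Inside Ω b → Inside Ω b' →
      (P.mesh 0)⁻¹ * ∑ i : Ix N, ‖covDeriv C (Pf + Y) (propagatorK C Ω (Pf + Y) msq a k (dip C (Pf + Y) b' (onb N i))) b‖
        ≤ maj P k cPYm 0 δ b.src b'.src)
    (hI : ∀ x : HiggsLattice.Site P 0, Interior k K₀ Ω₂ x → x ∈ Ω ∧ ∀ μ : Fin P.d, x.shift μ ∈ Ω)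
    (hfarI : ∀ x x' : HiggsLattice.Site P 0, Interior k K₀ Ω₂ x → Interior k K₀ Ω₂ x' →
      ∀ b : HiggsLattice.PBond P 0, Pf b ≠ 0 → ∀ z : HiggsLattice.Site P 0, blockIter k z = blockIter k b.src →
        Far P k ρ x z ∧ Far P k ρ z x') :
    (sect2Smooth116 hL1 C Ω Ω₂ Pf Y msq a k K₀ r₀ m c₁ c₂ (P.mesh k) 1).Ineq25At 1 0 0 (min δG (δ / 4))
      (CG + (P.mesh 0 ^ P.d)⁻¹ * farF P δ ρ *
        (smoothConst P.d m c₁ (c₂ + 2 * c₁) *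
            ((collarC P N k δ 2 1 2 cY cYd cPY (cPYd + Real.exp 1 * cPY * P.mesh k * (|C.e| * s)) (|C.e| * s) 0 ((|C.e| * s) ^ 2) (|C.e| * s) 0
            (|B1.aSeq a P.L k| * (P.mesh k)⁻¹ ^ 2 *
              ((|C.e| * s * P.mesh 0 * (P.d * ((P.L : ℝ) ^ k - 1))) * (2 + |C.e| * s * P.mesh 0 * (P.d * ((P.L : ℝ) ^ k - 1)))))
              + collarC P N k δ 2 1 2 cPY (cPYd + Real.exp 1 * cPY * P.mesh k * (|C.e| * s)) cY cYd (|C.e| * s) 0 ((|C.e| * s) ^ 2) (|C.e| * s) 0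
            (|B1.aSeq a P.L k| * (P.mesh k)⁻¹ ^ 2 *
              ((|C.e| * s * P.mesh 0 * (P.d * ((P.L : ℝ) ^ k - 1))) * (2 + |C.e| * s * P.mesh 0 * (P.d * ((P.L : ℝ) ^ k - 1))))))
            + (collarC P N k δ 1 0 2 cYd cYm cPY (cPYd + Real.exp 1 * cPY * P.mesh k * (|C.e| * s)) (|C.e| * s) 0 ((|C.e| * s) ^ 2) (|C.e| * s) 0
            (|B1.aSeq a P.L k| * (P.mesh k)⁻¹ ^ 2 *
              ((|C.e| * s * P.mesh 0 * (P.d * ((P.L : ℝ) ^ k - 1))) * (2 + |C.e| * s * P.mesh 0 * (P.d * ((P.L : ℝ) ^ k - 1)))))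
              + collarC P N k δ 1 0 2 cPYd (cPYm + Real.exp 1 * cPYd * P.mesh k * ((|C.e| * s) * (Fintype.card (Ix N) : ℝ))) cY cYd (|C.e| * s) 0 ((|C.e| * s) ^ 2) (|C.e| * s) 0
            (|B1.aSeq a P.L k| * (P.mesh k)⁻¹ ^ 2 *
              ((|C.e| * s * P.mesh 0 * (P.d * ((P.L : ℝ) ^ k - 1))) * (2 + |C.e| * s * P.mesh 0 * (P.d * ((P.L : ℝ) ^ k - 1)))))))
          + (2 * (collarC P N k δ 1 0 2 cYd cYm cPY (cPYd + Real.exp 1 * cPY * P.mesh k * (|C.e| * s)) (|C.e| * s) 0 ((|C.e| * s) ^ 2) (|C.e| * s) 0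
            (|B1.aSeq a P.L k| * (P.mesh k)⁻¹ ^ 2 *
              ((|C.e| * s * P.mesh 0 * (P.d * ((P.L : ℝ) ^ k - 1))) * (2 + |C.e| * s * P.mesh 0 * (P.d * ((P.L : ℝ) ^ k - 1)))))
              + collarC P N k δ 1 0 2 cPYd (cPYm + Real.exp 1 * cPYd * P.mesh k * ((|C.e| * s) * (Fintype.card (Ix N) : ℝ))) cY cYd (|C.e| * s) 0 ((|C.e| * s) ^ 2) (|C.e| * s) 0
            (|B1.aSeq a P.L k| * (P.mesh k)⁻¹ ^ 2 *
              ((|C.e| * s * P.mesh 0 * (P.d * ((P.L : ℝ) ^ k - 1))) * (2 + |C.e| * s * P.mesh 0 * (P.d * ((P.L : ℝ) ^ k - 1))))))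
            + P.d * m * (collarC P N k δ 1 0 1 cYd cYm ((Fintype.card (Ix N) : ℝ) * cPYd) (cPYm + Real.exp 1 * cPYd * P.mesh k * ((|C.e| * s) * (Fintype.card (Ix N) : ℝ))) (|C.e| * s) 0 ((|C.e| * s) ^ 2) (|C.e| * s) 0
            (|B1.aSeq a P.L k| * (P.mesh k)⁻¹ ^ 2 *
              ((|C.e| * s * P.mesh 0 * (P.d * ((P.L : ℝ) ^ k - 1))) * (2 + |C.e| * s * P.mesh 0 * (P.d * ((P.L : ℝ) ^ k - 1)))))
              + collarC P N k δ 1 0 1 cPYd (cPYm + Real.exp 1 * cPYd * P.mesh k * ((|C.e| * s) * (Fintype.card (Ix N) : ℝ))) ((Fintype.card (Ix N) : ℝ) * cYd) cYm (|C.e| * s) 0 ((|C.e| * s) ^ 2) (|C.e| * s) 0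
            (|B1.aSeq a P.L k| * (P.mesh k)⁻¹ ^ 2 *
              ((|C.e| * s * P.mesh 0 * (P.d * ((P.L : ℝ) ^ k - 1))) * (2 + |C.e| * s * P.mesh 0 * (P.d * ((P.L : ℝ) ^ k - 1))))))))) ∧
    (sect2Smooth116 hL1 C Ω Ω₂ Pf Y msq a k K₀ r₀ m c₁ c₂ (P.mesh k) 1).Ineq25At 0 1 0 (min δG (δ / 4))
      (CG + (P.mesh 0 ^ P.d)⁻¹ * farF P δ ρ *
        (smoothConst P.d m c₁ (c₂ + 2 * c₁) *
            ((collarC P N k δ 2 1 2 cY cYd cPY (cPYd + Real.exp 1 * cPY * P.mesh k * (|C.e| * s)) (|C.e| * s) 0 ((|C.e| * s) ^ 2) (|C.e| * s) 0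
            (|B1.aSeq a P.L k| * (P.mesh k)⁻¹ ^ 2 *
              ((|C.e| * s * P.mesh 0 * (P.d * ((P.L : ℝ) ^ k - 1))) * (2 + |C.e| * s * P.mesh 0 * (P.d * ((P.L : ℝ) ^ k - 1)))))
              + collarC P N k δ 2 1 2 cPY (cPYd + Real.exp 1 * cPY * P.mesh k * (|C.e| * s)) cY cYd (|C.e| * s) 0 ((|C.e| * s) ^ 2) (|C.e| * s) 0
            (|B1.aSeq a P.L k| * (P.mesh k)⁻¹ ^ 2 *
              ((|C.e| * s * P.mesh 0 * (P.d * ((P.L : ℝ) ^ k - 1))) * (2 + |C.e| * s * P.mesh 0 * (P.d * ((P.L : ℝ) ^ k - 1))))))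
            + (collarC P N k δ 1 0 2 cYd cYm cPY (cPYd + Real.exp 1 * cPY * P.mesh k * (|C.e| * s)) (|C.e| * s) 0 ((|C.e| * s) ^ 2) (|C.e| * s) 0
            (|B1.aSeq a P.L k| * (P.mesh k)⁻¹ ^ 2 *
              ((|C.e| * s * P.mesh 0 * (P.d * ((P.L : ℝ) ^ k - 1))) * (2 + |C.e| * s * P.mesh 0 * (P.d * ((P.L : ℝ) ^ k - 1)))))
              + collarC P N k δ 1 0 2 cPYd (cPYm + Real.exp 1 * cPYd * P.mesh k * ((|C.e| * s) * (Fintype.card (Ix N) : ℝ))) cY cYd (|C.e| * s) 0 ((|C.e| * s) ^ 2) (|C.e| * s) 0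
            (|B1.aSeq a P.L k| * (P.mesh k)⁻¹ ^ 2 *
              ((|C.e| * s * P.mesh 0 * (P.d * ((P.L : ℝ) ^ k - 1))) * (2 + |C.e| * s * P.mesh 0 * (P.d * ((P.L : ℝ) ^ k - 1)))))))
          + (2 * (collarC P N k δ 1 0 2 cYd cYm cPY (cPYd + Real.exp 1 * cPY * P.mesh k * (|C.e| * s)) (|C.e| * s) 0 ((|C.e| * s) ^ 2) (|C.e| * s) 0
            (|B1.aSeq a P.L k| * (P.mesh k)⁻¹ ^ 2 *
              ((|C.e| * s * P.mesh 0 * (P.d * ((P.L : ℝ) ^ k - 1))) * (2 + |C.e| * s * P.mesh 0 * (P.d * ((P.L : ℝ) ^ k - 1)))))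
              + collarC P N k δ 1 0 2 cPYd (cPYm + Real.exp 1 * cPYd * P.mesh k * ((|C.e| * s) * (Fintype.card (Ix N) : ℝ))) cY cYd (|C.e| * s) 0 ((|C.e| * s) ^ 2) (|C.e| * s) 0
            (|B1.aSeq a P.L k| * (P.mesh k)⁻¹ ^ 2 *
              ((|C.e| * s * P.mesh 0 * (P.d * ((P.L : ℝ) ^ k - 1))) * (2 + |C.e| * s * P.mesh 0 * (P.d * ((P.L : ℝ) ^ k - 1))))))
            + P.d * m * (collarC P N k δ 1 0 1 cYd cYm ((Fintype.card (Ix N) : ℝ) * cPYd) (cPYm + Real.exp 1 * cPYd * P.mesh k * ((|C.e| * s) * (Fintype.card (Ix N) : ℝ))) (|C.e| * s) 0 ((|C.e| * s) ^ 2) (|C.e| * s) 0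
            (|B1.aSeq a P.L k| * (P.mesh k)⁻¹ ^ 2 *
              ((|C.e| * s * P.mesh 0 * (P.d * ((P.L : ℝ) ^ k - 1))) * (2 + |C.e| * s * P.mesh 0 * (P.d * ((P.L : ℝ) ^ k - 1)))))
              + collarC P N k δ 1 0 1 cPYd (cPYm + Real.exp 1 * cPYd * P.mesh k * ((|C.e| * s) * (Fintype.card (Ix N) : ℝ))) ((Fintype.card (Ix N) : ℝ) * cYd) cYm (|C.e| * s) 0 ((|C.e| * s) ^ 2) (|C.e| * s) 0
            (|B1.aSeq a P.L k| * (P.mesh k)⁻¹ ^ 2 *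
              ((|C.e| * s * P.mesh 0 * (P.d * ((P.L : ℝ) ^ k - 1))) * (2 + |C.e| * s * P.mesh 0 * (P.d * ((P.L : ℝ) ^ k - 1))))))))) := by
  -- names for the six row constants
  set κ₄ : ℝ := (|B1.aSeq a P.L k| * (P.mesh k)⁻¹ ^ 2 *
              ((|C.e| * s * P.mesh 0 * (P.d * ((P.L : ℝ) ^ k - 1))) * (2 + |C.e| * s * P.mesh 0 * (P.d * ((P.L : ℝ) ^ k - 1))))) with hκ₄
  set C10v : ℝ := collarC P N k δ 2 1 2 cY cYd cPY (cPYd + Real.exp 1 * cPY * P.mesh k * (|C.e| * s)) (|C.e| * s) 0 ((|C.e| * s) ^ 2) (|C.e| * s) 0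
            (|B1.aSeq a P.L k| * (P.mesh k)⁻¹ ^ 2 *
              ((|C.e| * s * P.mesh 0 * (P.d * ((P.L : ℝ) ^ k - 1))) * (2 + |C.e| * s * P.mesh 0 * (P.d * ((P.L : ℝ) ^ k - 1))))) with hC10v
  set C01v : ℝ := collarC P N k δ 2 1 2 cPY (cPYd + Real.exp 1 * cPY * P.mesh k * (|C.e| * s)) cY cYd (|C.e| * s) 0 ((|C.e| * s) ^ 2) (|C.e| * s) 0
            (|B1.aSeq a P.L k| * (P.mesh k)⁻¹ ^ 2 *
              ((|C.e| * s * P.mesh 0 * (P.d * ((P.L : ℝ) ^ k - 1))) * (2 + |C.e| * s * P.mesh 0 * (P.d * ((P.L : ℝ) ^ k - 1))))) with hC01v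
  set C10d : ℝ := collarC P N k δ 1 0 2 cYd cYm cPY (cPYd + Real.exp 1 * cPY * P.mesh k * (|C.e| * s)) (|C.e| * s) 0 ((|C.e| * s) ^ 2) (|C.e| * s) 0
            (|B1.aSeq a P.L k| * (P.mesh k)⁻¹ ^ 2 *
              ((|C.e| * s * P.mesh 0 * (P.d * ((P.L : ℝ) ^ k - 1))) * (2 + |C.e| * s * P.mesh 0 * (P.d * ((P.L : ℝ) ^ k - 1))))) with hC10d
  set C01d : ℝ := collarC P N k δ 1 0 2 cPYd (cPYm + Real.exp 1 * cPYd * P.mesh k * ((|C.e| * s) * (Fintype.card (Ix N) : ℝ))) cY cYd (|C.e| * s) 0 ((|C.e| * s) ^ 2) (|C.e| * s) 0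
            (|B1.aSeq a P.L k| * (P.mesh k)⁻¹ ^ 2 *
              ((|C.e| * s * P.mesh 0 * (P.d * ((P.L : ℝ) ^ k - 1))) * (2 + |C.e| * s * P.mesh 0 * (P.d * ((P.L : ℝ) ^ k - 1))))) with hC01d
  set C10m : ℝ := collarC P N k δ 1 0 1 cYd cYm ((Fintype.card (Ix N) : ℝ) * cPYd) (cPYm + Real.exp 1 * cPYd * P.mesh k * ((|C.e| * s) * (Fintype.card (Ix N) : ℝ))) (|C.e| * s) 0 ((|C.e| * s) ^ 2) (|C.e| * s) 0
            (|B1.aSeq a P.L k| * (P.mesh k)⁻¹ ^ 2 *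
              ((|C.e| * s * P.mesh 0 * (P.d * ((P.L : ℝ) ^ k - 1))) * (2 + |C.e| * s * P.mesh 0 * (P.d * ((P.L : ℝ) ^ k - 1))))) with hC10m
  set C01m : ℝ := collarC P N k δ 1 0 1 cPYd (cPYm + Real.exp 1 * cPYd * P.mesh k * ((|C.e| * s) * (Fintype.card (Ix N) : ℝ))) ((Fintype.card (Ix N) : ℝ) * cYd) cYm (|C.e| * s) 0 ((|C.e| * s) ^ 2) (|C.e| * s) 0
            (|B1.aSeq a P.L k| * (P.mesh k)⁻¹ ^ 2 *
              ((|C.e| * s * P.mesh 0 * (P.d * ((P.L : ℝ) ^ k - 1))) * (2 + |C.e| * s * P.mesh 0 * (P.d * ((P.L : ℝ) ^ k - 1))))) with hC01m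
  -- nonnegativity
  have hL1' : 1 < P.L := hL1
  have hF : 0 ≤ farF P δ ρ := (farF_pos hδ ρ).le
  have hES : 0 ≤ |C.e| * s := mul_nonneg (abs_nonneg _) hs
  have hNC : 0 ≤ (Fintype.card (Ix N) : ℝ) := Nat.cast_nonneg _
  have hmk : 0 ≤ P.mesh k := (P.mesh_pos k).le
  have he1 : 0 ≤ Real.exp 1 := (Real.exp_pos 1).le
  have hκ₄0 : 0 ≤ κ₄ := by
    have := B3Op116CollarSources.avgM_nonneg (P := P) C k hs
    rw [hκ₄]; positivity
  have hcPYd' : 0 ≤ cPYd + Real.exp 1 * cPY * P.mesh k * (|C.e| * s) := by positivity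
  have hcPYm' : 0 ≤ cPYm + Real.exp 1 * cPYd * P.mesh k * ((|C.e| * s) * (Fintype.card (Ix N) : ℝ)) := by positivity
  have hC10v0 : 0 ≤ C10v := collarC_nonneg hL1' k hδ (by norm_num) hcY hcYd hcPY hcPYd' hES le_rfl (pow_nonneg hES 2) hES le_rfl hκ₄0
  have hC01v0 : 0 ≤ C01v := collarC_nonneg hL1' k hδ (by norm_num) hcPY hcPYd' hcY hcYd hES le_rfl (pow_nonneg hES 2) hES le_rfl hκ₄0
  have hC10d0 : 0 ≤ C10d := collarC_nonneg hL1' k hδ (by norm_num) hcYd hcYm hcPY hcPYd' hES le_rfl (pow_nonneg hES 2) hES le_rfl hκ₄0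
  have hC01d0 : 0 ≤ C01d := collarC_nonneg hL1' k hδ (by norm_num) hcPYd hcPYm' hcY hcYd hES le_rfl (pow_nonneg hES 2) hES le_rfl hκ₄0
  have hC10m0 : 0 ≤ C10m :=
    collarC_nonneg hL1' k hδ (by norm_num) hcYd hcYm (mul_nonneg hNC hcPYd) hcPYm' hES le_rfl (pow_nonneg hES 2) hES le_rfl hκ₄0
  have hC01m0 : 0 ≤ C01m :=
    collarC_nonneg hL1' k hδ (by norm_num) hcPYd hcPYm' (mul_nonneg hNC hcYd) hcYm hES le_rfl (pow_nonneg hES 2) hES le_rfl hκ₄0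
  have hεd : 0 ≤ (P.mesh 0 ^ P.d)⁻¹ := inv_nonneg.mpr (pow_nonneg (P.mesh_pos 0).le _)
  have hCV : 0 ≤ (P.mesh 0 ^ P.d)⁻¹ * (farF P δ ρ * (C10v + C01v)) := by positivity
  have hCD : 0 ≤ (P.mesh 0 ^ P.d)⁻¹ * (farF P δ ρ * (C10d + C01d)) := by positivity
  have hCM : 0 ≤ (P.mesh 0 ^ P.d)⁻¹ * (farF P δ ρ * (C10m + C01m)) := by positivity
  have hCH : 0 ≤ 2 * ((P.mesh 0 ^ P.d)⁻¹ * (farF P δ ρ * (C10d + C01d))) := by positivity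
  have hδ4 : 0 ≤ δ / 4 := by positivity
  have ht : 0 ≤ P.mesh k * 1 := by rw [mul_one]; exact hmk
  have ht1 : (P.mesh k * 1) ^ (1 + 0) = P.mesh k := by norm_num
  -- the currency conversion, for a row constant `c ≤ Csum`
  have conv : ∀ {c Csum S : ℝ} (e : ℝ) (n : ℕ), e = (n : ℝ) + 1 → ∀ {x x' : HiggsLattice.Site P 0},
      S ≤ top P k (farF P δ ρ * c) e (δ / 4) x x' → c ≤ Csum →
      (P.mesh 0 ^ P.d)⁻¹ * S ≤ ((P.mesh 0 ^ P.d)⁻¹ * (farF P δ ρ * Csum)) * P.mesh k * (P.mesh k ^ n * (P.mesh k ^ P.d)⁻¹) *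
        Real.exp (-(δ / 4 * ((HiggsLattice.Site.tdist x x' : ℝ) / (P.L : ℝ) ^ k))) := by
    intro c Csum S e n he x x' hS hc
    subst he
    have h1 : (P.mesh 0 ^ P.d)⁻¹ * S ≤ (P.mesh 0 ^ P.d)⁻¹ * top P k (farF P δ ρ * Csum) ((n : ℝ) + 1) (δ / 4) x x' :=
      mul_le_mul_of_nonneg_left (hS.trans (top_const_mono (mul_le_mul_of_nonneg_left hc hF) x x')) hεd
    exact h1.trans (top_le_binder le_rfl n (δ / 4) x x')
  -- the row-derivative binders (used twice: `hDv` and, through F3's `α = 0` lemma, `hH`)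
  have hDv : ∀ (μ : Fin P.d) (x x' : HiggsLattice.Site P 0), Interior k K₀ Ω₂ x → Interior k K₀ Ω₂ x' →
      (P.mesh 0 ^ P.d)⁻¹ * ∑ i' : Ix N, ‖covDeriv C Y (op116 C Ω Pf Y msq a k 1 0 (cb P N 0 (x', i'))) ⟨x, μ⟩‖
        ≤ ((P.mesh 0 ^ P.d)⁻¹ * (farF P δ ρ * (C10d + C01d))) * (P.mesh k * 1) ^ (1 + 0) * (P.mesh k * (P.mesh k ^ P.d)⁻¹) *
          Real.exp (-(δ / 4 * ((HiggsLattice.Site.tdist x x' : ℝ) / (P.L : ℝ) ^ k))) := by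
    intro μ x x' hx hx'
    have hb₀ : Inside Ω (⟨x, μ⟩ : HiggsLattice.PBond P 0) := ⟨(hI x hx).1, (hI x hx).2 μ⟩
    have hb := deriv_binder_one_zero C Ω Pf Y a hmsq hak hΩ hL2 hkK hδ hδ1 hρ hs hcYd hcYm hcPY hcPYd hP i₀ hdcolY hmixY hcolPY hdcolPY
      hb₀ (hI x' hx').1 (hfarI x x' hx hx')
    have h := conv 2 1 (by norm_num) hb (le_add_of_nonneg_right hC01d0)
    rw [pow_one] at h
    rwa [ht1]
  have hDv' : ∀ (μ : Fin P.d) (x x' : HiggsLattice.Site P 0), Interior k K₀ Ω₂ x → Interior k K₀ Ω₂ x' →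
      (P.mesh 0 ^ P.d)⁻¹ * ∑ i' : Ix N, ‖covDeriv C Y (op116 C Ω Pf Y msq a k 0 1 (cb P N 0 (x', i'))) ⟨x, μ⟩‖
        ≤ ((P.mesh 0 ^ P.d)⁻¹ * (farF P δ ρ * (C10d + C01d))) * (P.mesh k * 1) ^ (1 + 0) * (P.mesh k * (P.mesh k ^ P.d)⁻¹) *
          Real.exp (-(δ / 4 * ((HiggsLattice.Site.tdist x x' : ℝ) / (P.L : ℝ) ^ k))) := by
    intro μ x x' hx hx'
    have hb₀ : Inside Ω (⟨x, μ⟩ : HiggsLattice.PBond P 0) := ⟨(hI x hx).1, (hI x hx).2 μ⟩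
    have hb := deriv_binder_zero_one C Ω Pf Y a hmsq hak hΩ hL2 hkK hδ hδ1 hρ hs hcY hcYd hcPYd hcPYm hP i₀ hcolY hdcolY hdcolPY hmixPY
      hb₀ (hI x' hx').1 (hfarI x x' hx hx')
    have h := conv 2 1 (by norm_num) hb (le_add_of_nonneg_left hC10d0)
    rw [pow_one] at h
    rwa [ht1]
  have hCDt : 0 ≤ ((P.mesh 0 ^ P.d)⁻¹ * (farF P δ ρ * (C10d + C01d))) * (P.mesh k * 1) ^ (1 + 0) := by positivity
  have hV : ∀ (x x' : HiggsLattice.Site P 0), Interior k K₀ Ω₂ x → Interior k K₀ Ω₂ x' →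
      (P.mesh 0 ^ P.d)⁻¹ * ∑ i' : Ix N, ‖op116 C Ω Pf Y msq a k 1 0 (cb P N 0 (x', i')) x‖
        ≤ ((P.mesh 0 ^ P.d)⁻¹ * (farF P δ ρ * (C10v + C01v))) * (P.mesh k * 1) ^ (1 + 0) * (P.mesh k ^ 2 * (P.mesh k ^ P.d)⁻¹) *
          Real.exp (-(δ / 4 * ((HiggsLattice.Site.tdist x x' : ℝ) / (P.L : ℝ) ^ k))) := by
    intro x x' hx hx'
    have hb := value_binder_one_zero C Ω Pf Y a hmsq hak hΩ hL2 hkK hδ hδ1 hρ hs hcY hcYd hcPY hcPYd hP i₀ hcolY hdcolY hcolPY hdcolPY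
      (hI x hx).1 (hI x' hx').1 (hfarI x x' hx hx')
    have h := conv 3 2 (by norm_num) hb (le_add_of_nonneg_right hC01v0)
    rwa [ht1]
  have hV' : ∀ (x x' : HiggsLattice.Site P 0), Interior k K₀ Ω₂ x → Interior k K₀ Ω₂ x' →
      (P.mesh 0 ^ P.d)⁻¹ * ∑ i' : Ix N, ‖op116 C Ω Pf Y msq a k 0 1 (cb P N 0 (x', i')) x‖
        ≤ ((P.mesh 0 ^ P.d)⁻¹ * (farF P δ ρ * (C10v + C01v))) * (P.mesh k * 1) ^ (1 + 0) * (P.mesh k ^ 2 * (P.mesh k ^ P.d)⁻¹) *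
          Real.exp (-(δ / 4 * ((HiggsLattice.Site.tdist x x' : ℝ) / (P.L : ℝ) ^ k))) := by
    intro x x' hx hx'
    have hb := value_binder_zero_one C Ω Pf Y a hmsq hak hΩ hL2 hkK hδ hδ1 hρ hs hcY hcYd hcPY hcPYd hP i₀ hcolY hdcolY hcolPY hdcolPY
      (hI x hx).1 (hI x' hx').1 (hfarI x x' hx hx')
    have h := conv 3 2 (by norm_num) hb (le_add_of_nonneg_left hC10v0)
    rwa [ht1]
  have hM : ∀ (μ ν : Fin P.d) (x x' : HiggsLattice.Site P 0), Interior k K₀ Ω₂ x → Interior k K₀ Ω₂ x' →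
      (P.mesh 0 ^ P.d)⁻¹ * ((P.mesh 0)⁻¹ *
          ∑ i : Ix N, ‖covDeriv C Y (op116 C Ω Pf Y msq a k 1 0 (dip C Y ⟨x', ν⟩ (onb N i))) ⟨x, μ⟩‖)
        ≤ ((P.mesh 0 ^ P.d)⁻¹ * (farF P δ ρ * (C10m + C01m))) * (P.mesh k * 1) ^ (1 + 0) * (P.mesh k ^ P.d)⁻¹ *
          Real.exp (-(δ / 4 * ((HiggsLattice.Site.tdist x x' : ℝ) / (P.L : ℝ) ^ k))) := by
    intro μ ν x x' hx hx'
    have hb₀ : Inside Ω (⟨x, μ⟩ : HiggsLattice.PBond P 0) := ⟨(hI x hx).1, (hI x hx).2 μ⟩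
    have hc : Inside Ω (⟨x', ν⟩ : HiggsLattice.PBond P 0) := ⟨(hI x' hx').1, (hI x' hx').2 ν⟩
    have hb := mixed_binder_one_zero C Ω Pf Y a hmsq hak hΩ hL2 hkK hδ hδ1 hρ hs hcYd hcYm hcPYd hcPYm hP i₀ hdcolY hmixY hdcolPY hmixPY
      hb₀ hc (hfarI x x' hx hx')
    have h := conv 1 0 (by norm_num) hb (le_add_of_nonneg_right hC01m0)
    rw [pow_zero, one_mul] at h
    rwa [ht1]
  have hM' : ∀ (μ ν : Fin P.d) (x x' : HiggsLattice.Site P 0), Interior k K₀ Ω₂ x → Interior k K₀ Ω₂ x' →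
      (P.mesh 0 ^ P.d)⁻¹ * ((P.mesh 0)⁻¹ *
          ∑ i : Ix N, ‖covDeriv C Y (op116 C Ω Pf Y msq a k 0 1 (dip C Y ⟨x', ν⟩ (onb N i))) ⟨x, μ⟩‖)
        ≤ ((P.mesh 0 ^ P.d)⁻¹ * (farF P δ ρ * (C10m + C01m))) * (P.mesh k * 1) ^ (1 + 0) * (P.mesh k ^ P.d)⁻¹ *
          Real.exp (-(δ / 4 * ((HiggsLattice.Site.tdist x x' : ℝ) / (P.L : ℝ) ^ k))) := by
    intro μ ν x x' hx hx'
    have hb₀ : Inside Ω (⟨x, μ⟩ : HiggsLattice.PBond P 0) := ⟨(hI x hx).1, (hI x hx).2 μ⟩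
    have hc : Inside Ω (⟨x', ν⟩ : HiggsLattice.PBond P 0) := ⟨(hI x' hx').1, (hI x' hx').2 ν⟩
    have hb := mixed_binder_zero_one C Ω Pf Y a hmsq hak hΩ hL2 hkK hδ hδ1 hρ hs hcYd hcYm hcPYd hcPYm hP i₀ hdcolY hmixY hdcolPY hmixPY
      hb₀ hc (hfarI x x' hx hx')
    have h := conv 1 0 (by norm_num) hb (le_add_of_nonneg_left hC10m0)
    rw [pow_zero, one_mul] at h
    rwa [ht1]
  have hA := ineq25At_op116_smooth_of_bounds_inner hL2 hk1 hkK 1 0 le_rfl zero_le_one hc₁ hc₂ ht hCG hδ4 hCV hCD hCH hCM hδG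
    hV hV' hDv hDv'
    (fun μ x₁ x₂ x' Γ h₁ h₂ h' _ _ =>
      holder_row_zero_of_deriv_row C Y (op116 C Ω Pf Y msq a k 1 0) (Interior k K₀ Ω₂) hCDt hδ4 hDv μ x₁ x₂ x' Γ h₁ h₂ h')
    (fun μ x₁ x₂ x' Γ h₁ h₂ h' _ _ =>
      holder_row_zero_of_deriv_row C Y (op116 C Ω Pf Y msq a k 0 1) (Interior k K₀ Ω₂) hCDt hδ4 hDv' μ x₁ x₂ x' Γ h₁ h₂ h')
    hM hM'
  -- the order `(n,n′) = (0,1)`: the same eight binders with the roles of the two alternatives exchanged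
  have n01 : ∀ {c S E : ℝ}, c * (P.mesh k * 1) ^ (0 + 1) * S * E = c * (P.mesh k * 1) ^ (1 + 0) * S * E := by
    intros; norm_num
  have n01' : ∀ {θ c S E : ℝ}, θ * (c * (P.mesh k * 1) ^ (0 + 1) * S) * E = θ * (c * (P.mesh k * 1) ^ (1 + 0) * S) * E := by
    intros; norm_num
  have hA' := ineq25At_op116_smooth_of_bounds_inner hL2 hk1 hkK 0 1 le_rfl zero_le_one hc₁ hc₂ ht hCG hδ4 hCV hCD hCH hCM hδG
    (fun x x' hx hx' => by rw [n01]; exact hV' x x' hx hx') (fun x x' hx hx' => by rw [n01]; exact hV x x' hx hx')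
    (fun μ x x' hx hx' => by rw [n01]; exact hDv' μ x x' hx hx') (fun μ x x' hx hx' => by rw [n01]; exact hDv μ x x' hx hx')
    (fun μ x₁ x₂ x' Γ h₁ h₂ h' _ _ => by
      rw [n01']
      exact holder_row_zero_of_deriv_row C Y (op116 C Ω Pf Y msq a k 0 1) (Interior k K₀ Ω₂) hCDt hδ4 hDv' μ x₁ x₂ x' Γ h₁ h₂ h')
    (fun μ x₁ x₂ x' Γ h₁ h₂ h' _ _ => by
      rw [n01']
      exact holder_row_zero_of_deriv_row C Y (op116 C Ω Pf Y msq a k 1 0) (Interior k K₀ Ω₂) hCDt hδ4 hDv μ x₁ x₂ x' Γ h₁ h₂ h')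
    (fun μ ν x x' hx hx' => by rw [n01]; exact hM' μ ν x x' hx hx') (fun μ ν x x' hx hx' => by rw [n01]; exact hM μ ν x x' hx hx')
  constructor
  · convert hA using 2
    ring
  · convert hA' using 2
    ring

end Member

/-! ## §3 The (C)-level member on a cell-product box: the dictionary discharged -/

section Box

open scoped Classical

/-- **INEQUALITY (2.5) AT `(n,n′) = (1,0)`, `α = 0`, FOR THE ONE-`V_k` COLLAR OPERATOR ON A CELL-PRODUCT BOX `Ω = cellBox k K₀ S`, FROM
THE TREE'S DICTIONARY** — the (B)-level member `ineq25At_one_zero_collar_of_dict` with its six dictionary families DISCHARGED by p35 g21's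
`B3Op116BoxRows.colB_dcolB_le` (for `Y` and for `P + Y`, both (I.2.23)-regular on `Ω` with `L^kδ|e| ≤ t`) and p40's
`B3Op116CollarDict.mixedB_le`, and the `δG_k` clause by p33 g61's `ineq25_smooth_regularNested`, at a common cube size and a common rate:
for `d ≥ 1`, `L ≥ 2`, `a, m² > 0`, `c ≥ 0`, bump constants `c₁, c₂ ≥ 0`: ∃ `E₀ > 0` ∀ charge with `e² ≤ E₀` ∃ `K₀,min` ∀ `K₀ ≥ K₀,min`
∃ `t, δ, δ₀, C_G` such that for every volume with these `d, L`, `K₀ ∣ M`, every `1 ≤ k ≤ K` (`L^kε ≤ 1`, `3L^kK₀ ≤ |T_ε|_μ`), every `S`,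
every big-block union `Ω₂ ⊆ Ω`, all `Y, P` (regularity, smallness, `sup|P| ≤ s`, `ρ ≥ 1`) and the FAR GEOMETRY of `supp P` from the
interior points of `Ω₂`, there is `K ≥ 0` with `(sect2Smooth116 … P Y … (L^kε) 1).Ineq25At 1 0 0 (min δ₀ (δ/4)) (C_G + (ε^d)^{−1}·farF(δ,ρ)·K)`
(`K` = the explicit `collarC` combination of §2 at the dictionary constants; it depends on `k` — declared divergence from print's
`O(1)(e(L^kε)p(L^kε))`). [cite: Balaban1983Higgs3, (2.5) p.424, (1.16) p.414, (2.10) p.426, p.433] [cite: Balaban1982Higgs1, Prop. 2.1 p.610, (3.16) p.615] [cite: Balaban1983RegularityDecay, Theorem p.573] -/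
theorem ineq25At_one_zero_collarBox (d L : ℕ) (hd : 1 ≤ d) (hL : 2 ≤ L) {a : ℝ} (ha : 0 < a) {msq : ℝ} (hmsq : 0 < msq)
    {c : ℝ} (hc : 0 ≤ c) (N m : ℕ) {c₁ c₂ : ℝ} (hc₁ : 0 ≤ c₁) (hc₂ : 0 ≤ c₂) :
    ∃ E₀ : ℝ, 0 < E₀ ∧ ∀ (C : ChargeData N), C.e ^ 2 ≤ E₀ →
      ∃ K₀min : ℕ, ∀ K₀ : ℕ, K₀min ≤ K₀ → ∃ t δ δ₀ CG : ℝ, 0 < t ∧ 0 < δ ∧ δ ≤ 1 ∧ 0 < δ₀ ∧ 0 ≤ CG ∧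
      ∀ (P : HiggsLattice.Params) (hP1 : 1 < P.L), P.d = d → P.L = L → K₀ ∣ P.M →
      ∀ {k : ℕ}, 1 ≤ k → k ≤ P.K → (∀ μ, 3 * half P k K₀ ≤ P.sitesPerDir 0 μ) → P.mesh k ≤ 1 →
      ∀ (S : Fin P.d → Finset ℕ) (Ω₂ : Finset (HiggsLattice.Site P 0)), IsBigBlockUnion k K₀ Ω₂ → Ω₂ ⊆ cellBox k K₀ S →
      ∀ (Pf Y : HiggsLattice.VecField P 0) {δY δPY s ρ : ℝ}, 0 ≤ δY → 0 ≤ δPY → 0 ≤ s → 1 ≤ ρ →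
        (∀ z ∈ cellBox k K₀ S, ∀ μ ν : Fin P.d, |Y ⟨z.shift ν, μ⟩ - Y ⟨z, μ⟩| ≤ δY) →
        (∀ z ∈ cellBox k K₀ S, ∀ μ ν : Fin P.d, |(Pf + Y) ⟨z.shift ν, μ⟩ - (Pf + Y) ⟨z, μ⟩| ≤ δPY) →
        (P.L : ℝ) ^ k * δY * |C.e| ≤ t → (P.L : ℝ) ^ k * δPY * |C.e| ≤ t → (P.L : ℝ) ^ k * δY ≤ c * |C.e| →
        (∀ b : HiggsLattice.PBond P 0, |Pf b| ≤ s) →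
        (∀ x x' : HiggsLattice.Site P 0, Interior k K₀ Ω₂ x → Interior k K₀ Ω₂ x' →
          ∀ b : HiggsLattice.PBond P 0, Pf b ≠ 0 → ∀ z : HiggsLattice.Site P 0, blockIter k z = blockIter k b.src →
            Far P k ρ x z ∧ Far P k ρ z x') →
      ∀ r₀ : ℕ, Ix N →
        ∃ K : ℝ, 0 ≤ K ∧
          (sect2Smooth116 hP1 C (cellBox k K₀ S) Ω₂ Pf Y msq a k K₀ r₀ m c₁ c₂ (P.mesh k) 1).Ineq25At 1 0 0 (min δ₀ (δ / 4))
            (CG + (P.mesh 0 ^ P.d)⁻¹ * farF P δ ρ * K) ∧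
          (sect2Smooth116 hP1 C (cellBox k K₀ S) Ω₂ Pf Y msq a k K₀ r₀ m c₁ c₂ (P.mesh k) 1).Ineq25At 0 1 0 (min δ₀ (δ / 4))
            (CG + (P.mesh 0 ^ P.d)⁻¹ * farF P δ ρ * K) := by
  obtain ⟨E₀, hE₀, hG⟩ := ineq25_smooth_regularNested d L hd hL ha hmsq hc N m hc₁ hc₂
  refine ⟨E₀, hE₀, fun C heC => ?_⟩
  obtain ⟨K₃, hK₃⟩ := hG C heC
  obtain ⟨K₁, hK₁⟩ := colB_dcolB_le d L hd hL ha hmsq N C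
  obtain ⟨K₂, hK₂⟩ := mixedB_le d L hd hL ha hmsq N C
  refine ⟨max (max K₁ K₂) K₃, fun K₀ hK₀ => ?_⟩
  obtain ⟨t₁, δ₁, C₁, ht₁, hδ₁, hC₁, h1⟩ := hK₁ K₀ ((le_max_left K₁ K₂).trans ((le_max_left _ _).trans hK₀))
  obtain ⟨t₂, δ₂, C₂, ht₂, hδ₂, hC₂, h2⟩ := hK₂ K₀ ((le_max_right K₁ K₂).trans ((le_max_left _ _).trans hK₀))
  obtain ⟨t₃, δ₃, C₃, ht₃, hδ₃, hC₃, h3⟩ := hK₃ (le_refl (0 : ℝ)) zero_lt_one K₀ ((le_max_right _ _).trans hK₀)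
  -- the common smallness threshold and the common rate
  set t : ℝ := min (min t₁ t₂) t₃ with htdef
  set δ : ℝ := min (min δ₁ δ₂) 1 with hδdef
  have htt₁ : t ≤ t₁ := (min_le_left _ _).trans (min_le_left _ _)
  have htt₂ : t ≤ t₂ := (min_le_left _ _).trans (min_le_right _ _)
  have htt₃ : t ≤ t₃ := min_le_right _ _
  have hδδ₁ : δ ≤ δ₁ := (min_le_left _ _).trans (min_le_left _ _)
  have hδδ₂ : δ ≤ δ₂ := (min_le_left _ _).trans (min_le_right _ _)
  have hδ1 : δ ≤ 1 := min_le_right _ _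
  have hδ0 : 0 < δ := lt_min (lt_min hδ₁ hδ₂) one_pos
  refine ⟨t, δ, δ₃, C₃, lt_min (lt_min ht₁ ht₂) ht₃, hδ0, hδ1, hδ₃, hC₃.le, ?_⟩
  intro P hP1 hPd hPL hK₀M k hk hkK h3h hmesh S Ω₂ hΩ₂ hsub Pf Y δY δPY s ρ hδY hδPY hs hρ hregY hregPY htY htPY hcY hP hfarI r₀ i₀
  have hL2 : 2 ≤ P.L := by rw [hPL]; exact hL
  have hε := P.mesh_pos 0
  have hεd : 0 ≤ P.mesh 0 ^ P.d := pow_nonneg hε.le _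
  have hcC₁ : 0 ≤ P.mesh 0 ^ P.d * C₁ := mul_nonneg hεd hC₁.le
  have hcC₂ : 0 ≤ P.mesh 0 ^ P.d * C₂ := mul_nonneg hεd hC₂.le
  have hak : 0 ≤ B1.aSeq a P.L k := (B1.aSeq_pos ha (by exact_mod_cast hP1) hk).le
  have hΩ : ∀ x x' : HiggsLattice.Site P 0, blockIter k x = blockIter k x' → (x ∈ cellBox k K₀ S ↔ x' ∈ cellBox k K₀ S) :=
    blockUnion_of_isBigBlockUnion le_rfl (isBigBlockUnion_cellBox S)
  -- the dictionary of `G_k(Ω,X)` for `X = Y` and `X = P + Y`, at the common rate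
  have hdict : ∀ (X : HiggsLattice.VecField P 0) {δX : ℝ}, 0 ≤ δX →
      (∀ z ∈ cellBox k K₀ S, ∀ μ ν : Fin P.d, |X ⟨z.shift ν, μ⟩ - X ⟨z, μ⟩| ≤ δX) → (P.L : ℝ) ^ k * δX * |C.e| ≤ t →
      (∀ u y : HiggsLattice.Site P 0, u ∈ cellBox k K₀ S → y ∈ cellBox k K₀ S →
        ∑ i : Ix N, ‖propagatorK C (cellBox k K₀ S) X msq a k (cb P N 0 (y, i)) u‖ ≤ maj P k (P.mesh 0 ^ P.d * C₁) 2 δ u y) ∧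
      (∀ y ∈ cellBox k K₀ S, ∀ b : HiggsLattice.PBond P 0, Inside (cellBox k K₀ S) b →
        ∑ i : Ix N, ‖covDeriv C X (propagatorK C (cellBox k K₀ S) X msq a k (cb P N 0 (y, i))) b‖
          ≤ maj P k (P.mesh 0 ^ P.d * C₁) 1 δ b.src y) ∧
      (∀ b b' : HiggsLattice.PBond P 0, Inside (cellBox k K₀ S) b → Inside (cellBox k K₀ S) b' →
        (P.mesh 0)⁻¹ * ∑ i : Ix N, ‖covDeriv C X (propagatorK C (cellBox k K₀ S) X msq a k (dip C X b' (onb N i))) b‖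
          ≤ maj P k (P.mesh 0 ^ P.d * C₂) 0 δ b.src b'.src) := by
    intro X δX hδX hregX htX
    have hh := fun x y hx hy => h1 P hP1 hPd hPL hK₀M hk hkK h3h hmesh S X hδX hregX (htX.trans htt₁) x y hx hy
    refine ⟨fun u y hu hy => ?_, fun y hy b hb => ?_, fun b b' hb hb' => ?_⟩
    · exact ((hh u y hu hy).1).trans (maj_rate_mono hcC₁ hδδ₁ u y)
    · exact ((hh b.src y hb.1 hy).2 b.dir hb.2).trans (maj_rate_mono hcC₁ hδδ₁ b.src y)
    · exact (h2 P hP1 hPd hPL hK₀M hk hkK h3h hmesh S X hδX hregX (htX.trans htt₂) b.dir b'.dir b.src b'.src hb.1 hb.2 hb'.1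
        hb'.2).trans (maj_rate_mono hcC₂ hδδ₂ b.src b'.src)
  obtain ⟨hcolY, hdcolY, hmixY⟩ := hdict Y hδY hregY htY
  obtain ⟨hcolPY, hdcolPY, hmixPY⟩ := hdict (Pf + Y) hδPY hregPY htPY
  -- the `δG_k(Ω,Ω₂,Y)` clause with smooth localizations at `α = 0`
  have hδG : (sect2DeltaSmooth hP1 C (cellBox k K₀ S) Ω₂ Y msq a k K₀ r₀ m c₁ c₂).Ineq25 0 δ₃ C₃ :=
    h3 P hP1 hPd hPL hK₀M hk hkK h3h hmesh (cellBox k K₀ S) Ω₂ (isBigBlockUnion_cellBox S) hΩ₂ hsub Y hδY hregY (htY.trans htt₃) hcY r₀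
  -- geometry: interior points of `Ω₂ ⊆ Ω` and their forward neighbours lie in `Ω`
  have hI : ∀ x : HiggsLattice.Site P 0, Interior k K₀ Ω₂ x → x ∈ cellBox k K₀ S ∧ ∀ μ : Fin P.d, x.shift μ ∈ cellBox k K₀ S :=
    fun x hx => ⟨hsub hx.mem, fun μ => hsub (hx.shift_mem μ)⟩
  have hmem := ineq25At_one_zero_collar_of_dict (K₀ := K₀) (r₀ := r₀) (m := m) (hL1 := hP1) (c₁ := c₁) (c₂ := c₂) C (cellBox k K₀ S) Ω₂
    Pf Y a hmsq hak hΩ hL2 hk hkK hδ0 hδ1 hρ hs hcC₁ hcC₁ hcC₂ hcC₁ hcC₁ hcC₂ hP i₀ hc₁ hc₂ hC₃.le hδG hcolY hdcolY hmixY hcolPY hdcolPY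
    hmixPY hI hfarI
  refine ⟨(smoothConst P.d m c₁ (c₂ + 2 * c₁) *
            ((collarC P N k δ 2 1 2 (P.mesh 0 ^ P.d * C₁) (P.mesh 0 ^ P.d * C₁) (P.mesh 0 ^ P.d * C₁) ((P.mesh 0 ^ P.d * C₁) + Real.exp 1 * (P.mesh 0 ^ P.d * C₁) * P.mesh k * (|C.e| * s)) (|C.e| * s) 0 ((|C.e| * s) ^ 2) (|C.e| * s) 0
            (|B1.aSeq a P.L k| * (P.mesh k)⁻¹ ^ 2 *
              ((|C.e| * s * P.mesh 0 * (P.d * ((P.L : ℝ) ^ k - 1))) * (2 + |C.e| * s * P.mesh 0 * (P.d * ((P.L : ℝ) ^ k - 1)))))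
              + collarC P N k δ 2 1 2 (P.mesh 0 ^ P.d * C₁) ((P.mesh 0 ^ P.d * C₁) + Real.exp 1 * (P.mesh 0 ^ P.d * C₁) * P.mesh k * (|C.e| * s)) (P.mesh 0 ^ P.d * C₁) (P.mesh 0 ^ P.d * C₁) (|C.e| * s) 0 ((|C.e| * s) ^ 2) (|C.e| * s) 0
            (|B1.aSeq a P.L k| * (P.mesh k)⁻¹ ^ 2 *
              ((|C.e| * s * P.mesh 0 * (P.d * ((P.L : ℝ) ^ k - 1))) * (2 + |C.e| * s * P.mesh 0 * (P.d * ((P.L : ℝ) ^ k - 1))))))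
            + (collarC P N k δ 1 0 2 (P.mesh 0 ^ P.d * C₁) (P.mesh 0 ^ P.d * C₂) (P.mesh 0 ^ P.d * C₁) ((P.mesh 0 ^ P.d * C₁) + Real.exp 1 * (P.mesh 0 ^ P.d * C₁) * P.mesh k * (|C.e| * s)) (|C.e| * s) 0 ((|C.e| * s) ^ 2) (|C.e| * s) 0
            (|B1.aSeq a P.L k| * (P.mesh k)⁻¹ ^ 2 *
              ((|C.e| * s * P.mesh 0 * (P.d * ((P.L : ℝ) ^ k - 1))) * (2 + |C.e| * s * P.mesh 0 * (P.d * ((P.L : ℝ) ^ k - 1)))))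
              + collarC P N k δ 1 0 2 (P.mesh 0 ^ P.d * C₁) ((P.mesh 0 ^ P.d * C₂) + Real.exp 1 * (P.mesh 0 ^ P.d * C₁) * P.mesh k * ((|C.e| * s) * (Fintype.card (Ix N) : ℝ))) (P.mesh 0 ^ P.d * C₁) (P.mesh 0 ^ P.d * C₁) (|C.e| * s) 0 ((|C.e| * s) ^ 2) (|C.e| * s) 0
            (|B1.aSeq a P.L k| * (P.mesh k)⁻¹ ^ 2 *
              ((|C.e| * s * P.mesh 0 * (P.d * ((P.L : ℝ) ^ k - 1))) * (2 + |C.e| * s * P.mesh 0 * (P.d * ((P.L : ℝ) ^ k - 1)))))))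
          + (2 * (collarC P N k δ 1 0 2 (P.mesh 0 ^ P.d * C₁) (P.mesh 0 ^ P.d * C₂) (P.mesh 0 ^ P.d * C₁) ((P.mesh 0 ^ P.d * C₁) + Real.exp 1 * (P.mesh 0 ^ P.d * C₁) * P.mesh k * (|C.e| * s)) (|C.e| * s) 0 ((|C.e| * s) ^ 2) (|C.e| * s) 0
            (|B1.aSeq a P.L k| * (P.mesh k)⁻¹ ^ 2 *
              ((|C.e| * s * P.mesh 0 * (P.d * ((P.L : ℝ) ^ k - 1))) * (2 + |C.e| * s * P.mesh 0 * (P.d * ((P.L : ℝ) ^ k - 1)))))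
              + collarC P N k δ 1 0 2 (P.mesh 0 ^ P.d * C₁) ((P.mesh 0 ^ P.d * C₂) + Real.exp 1 * (P.mesh 0 ^ P.d * C₁) * P.mesh k * ((|C.e| * s) * (Fintype.card (Ix N) : ℝ))) (P.mesh 0 ^ P.d * C₁) (P.mesh 0 ^ P.d * C₁) (|C.e| * s) 0 ((|C.e| * s) ^ 2) (|C.e| * s) 0
            (|B1.aSeq a P.L k| * (P.mesh k)⁻¹ ^ 2 *
              ((|C.e| * s * P.mesh 0 * (P.d * ((P.L : ℝ) ^ k - 1))) * (2 + |C.e| * s * P.mesh 0 * (P.d * ((P.L : ℝ) ^ k - 1))))))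
            + P.d * m * (collarC P N k δ 1 0 1 (P.mesh 0 ^ P.d * C₁) (P.mesh 0 ^ P.d * C₂) ((Fintype.card (Ix N) : ℝ) * (P.mesh 0 ^ P.d * C₁)) ((P.mesh 0 ^ P.d * C₂) + Real.exp 1 * (P.mesh 0 ^ P.d * C₁) * P.mesh k * ((|C.e| * s) * (Fintype.card (Ix N) : ℝ))) (|C.e| * s) 0 ((|C.e| * s) ^ 2) (|C.e| * s) 0
            (|B1.aSeq a P.L k| * (P.mesh k)⁻¹ ^ 2 *
              ((|C.e| * s * P.mesh 0 * (P.d * ((P.L : ℝ) ^ k - 1))) * (2 + |C.e| * s * P.mesh 0 * (P.d * ((P.L : ℝ) ^ k - 1)))))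
              + collarC P N k δ 1 0 1 (P.mesh 0 ^ P.d * C₁) ((P.mesh 0 ^ P.d * C₂) + Real.exp 1 * (P.mesh 0 ^ P.d * C₁) * P.mesh k * ((|C.e| * s) * (Fintype.card (Ix N) : ℝ))) ((Fintype.card (Ix N) : ℝ) * (P.mesh 0 ^ P.d * C₁)) (P.mesh 0 ^ P.d * C₂) (|C.e| * s) 0 ((|C.e| * s) ^ 2) (|C.e| * s) 0
            (|B1.aSeq a P.L k| * (P.mesh k)⁻¹ ^ 2 *
              ((|C.e| * s * P.mesh 0 * (P.d * ((P.L : ℝ) ^ k - 1))) * (2 + |C.e| * s * P.mesh 0 * (P.d * ((P.L : ℝ) ^ k - 1)))))))), ?_, hmem⟩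
  -- nonnegativity of the constant
  have hF : 0 ≤ farF P δ ρ := (farF_pos hδ0 ρ).le
  have hES : 0 ≤ |C.e| * s := mul_nonneg (abs_nonneg _) hs
  have hNC : 0 ≤ (Fintype.card (Ix N) : ℝ) := Nat.cast_nonneg _
  have hmk : 0 ≤ P.mesh k := (P.mesh_pos k).le
  have he1 : 0 ≤ Real.exp 1 := (Real.exp_pos 1).le
  have hm0 := B3Op116CollarSources.avgM_nonneg (P := P) C k hs
  have hκ₄0 : 0 ≤ |B1.aSeq a P.L k| * (P.mesh k)⁻¹ ^ 2 *
      ((|C.e| * s * P.mesh 0 * (P.d * ((P.L : ℝ) ^ k - 1))) * (2 + |C.e| * s * P.mesh 0 * (P.d * ((P.L : ℝ) ^ k - 1)))) := by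
    positivity
  have hsm : 0 ≤ smoothConst P.d m c₁ (c₂ + 2 * c₁) := (B3Ineq31SmoothLocalization.smoothConst_pos P.d m hc₁ (by positivity)).le
  have hd0 : (0 : ℝ) ≤ (P.d : ℝ) := Nat.cast_nonneg _
  have hm' : (0 : ℝ) ≤ (m : ℝ) := Nat.cast_nonneg _
  have c1 := collarC_nonneg (N := N) (aK := 2) (aKd := 1) hP1 k hδ0 (by norm_num : (0 : ℝ) < 2) hcC₁ hcC₁ hcC₁ (by positivity : 0 ≤ P.mesh 0 ^ P.d * C₁ +
    Real.exp 1 * (P.mesh 0 ^ P.d * C₁) * P.mesh k * (|C.e| * s)) hES le_rfl (pow_nonneg hES 2) hES le_rfl hκ₄0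
  have c2 := collarC_nonneg (N := N) (aK := 2) (aKd := 1) hP1 k hδ0 (by norm_num : (0 : ℝ) < 2) hcC₁ (by positivity : 0 ≤ P.mesh 0 ^ P.d * C₁ +
    Real.exp 1 * (P.mesh 0 ^ P.d * C₁) * P.mesh k * (|C.e| * s)) hcC₁ hcC₁ hES le_rfl (pow_nonneg hES 2) hES le_rfl hκ₄0
  have c3 := collarC_nonneg (N := N) (aK := 1) (aKd := 0) hP1 k hδ0 (by norm_num : (0 : ℝ) < 2) hcC₁ hcC₂ hcC₁ (by positivity : 0 ≤ P.mesh 0 ^ P.d * C₁ +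
    Real.exp 1 * (P.mesh 0 ^ P.d * C₁) * P.mesh k * (|C.e| * s)) hES le_rfl (pow_nonneg hES 2) hES le_rfl hκ₄0
  have c4 := collarC_nonneg (N := N) (aK := 1) (aKd := 0) hP1 k hδ0 (by norm_num : (0 : ℝ) < 2) hcC₁ (by positivity : 0 ≤ P.mesh 0 ^ P.d * C₂ +
    Real.exp 1 * (P.mesh 0 ^ P.d * C₁) * P.mesh k * (|C.e| * s * (Fintype.card (Ix N) : ℝ))) hcC₁ hcC₁ hES le_rfl (pow_nonneg hES 2)
    hES le_rfl hκ₄0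
  have c5 := collarC_nonneg (N := N) (aK := 1) (aKd := 0) hP1 k hδ0 (by norm_num : (0 : ℝ) < 1) hcC₁ hcC₂ (mul_nonneg hNC hcC₁) (by positivity : 0 ≤
    P.mesh 0 ^ P.d * C₂ + Real.exp 1 * (P.mesh 0 ^ P.d * C₁) * P.mesh k * (|C.e| * s * (Fintype.card (Ix N) : ℝ))) hES le_rfl
    (pow_nonneg hES 2) hES le_rfl hκ₄0
  have c6 := collarC_nonneg (N := N) (aK := 1) (aKd := 0) hP1 k hδ0 (by norm_num : (0 : ℝ) < 1) hcC₁ (by positivity : 0 ≤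
    P.mesh 0 ^ P.d * C₂ + Real.exp 1 * (P.mesh 0 ^ P.d * C₁) * P.mesh k * (|C.e| * s * (Fintype.card (Ix N) : ℝ)))
    (mul_nonneg hNC hcC₁) hcC₂ hES le_rfl (pow_nonneg hES 2) hES le_rfl hκ₄0
  positivity

end Box



end Literature.MathematicalPhysics.QuantumFieldTheory.Balaban1983to89.B3Ineq25Op116CollarRegion

end
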